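import Summits.Ventures.QEC.Census.HB.HB104.BZData
import HarnessLib

/-!
# `HB104` — `bz` certificate, side Z: the STRUCTURAL check (tier KERNEL), emitted by qec-search-7

`cert.bzZStruct bzData = true` by `decide +kernel`: the two rank certificates (O3), the pairing of `LX`/`LZ` (O4),
`n = r_X + r_Z + k`, word sizes, the parity witness (C2, if any) and the label cover (C5) — everything of the side
except the block replays (`BZBlocksZ*.lean`) and the information-set facts (`BZInfoSetsZ.lean`).
-/

namespace Summit.Ventures.QEC.Census.HB104

/-- Structural part of side Z of the `bz` certificate of `HB104` (kernel `decide`). -/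
theorem bzZStruct_ok : HB104.cert.bzZStruct HB104.bzData = true := by
  decide +kernel

/-- Row-count check of side Z (`kb = |G_b|` for every matrix; kernel `decide`). -/
theorem bzZLen_ok : HB104.cert.bzZLen HB104.bzData = true := by
  decide +kernel

end Summit.Ventures.QEC.Census.HB104
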